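import Summits.QuantumFields.YangMills.Theorems.BalabanUVNodesN07SplitClauseHeadKnit
import Summits.QuantumFields.YangMills.Theorems.BalabanUVNodesK0HalvingStepOfCoreGuardedChain
import Summits.QuantumFields.YangMills.Theorems.BalabanUVNodesN07SplitClauseLevelRaising
import Summits.QuantumFields.YangMills.Theorems.BalabanUVNodesN07DatumGauge152GuardedBox
import HarnessLib

/-!
# N07 [B11] (= [15] = [Balaban1985Variational]) Sect. F, road of record R0′, S6 HEAD: **THE KNIT WITH RANGED LETTER HYPOTHESES** — FILE 5's knit and FILE 6's V20-G stub-1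
# shape RE-STATED with `HLETTERS` ∕ `HBUDGET` asked ONLY IN THE TOKEN's RANGE `0 < δ_j ≤ a₁`, `B₃δ_j ≤ ε_j ≤ a₀` (the editions of record for consumers; FILE 5∕6's unranged
# hypotheses remain valid but force letter functions to be defined off-range — a located wart of this seat's own FILE 5, repaired here); AND with `HCHART` asked ONLY AT CLEAN
# DATUMS (print p. 300; n07-e LOCATED-INWARD-DATUM) through n07-e's level-raising reduction `N07SplitClauseLevelRaising.datumGaugeSplitTopStepCoreG_of_clean` (p639318) and
# n07-w3's BOX-keyed guarded S3 door — THE EDITIONS OF RECORD of the knit and of the V20-G stub-1 shape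

Cell `pub-ymgap`, width seat `pub-ymgap-dag-n07-w4` g4 (sub-target S6 = the HEAD), CLAIM-7 ∕ INTENT-7 (cell bus).  `--kind proof --supports stmt-QuantumFields-27364 --as helper`
(K1⁹ per dag-lead KEY MAP v2); count-neutral; def-free.  [15] = [Balaban1985Variational]; [6] = [Balaban1985RegularSpaces]; [4] = [Balaban1984PropagatorsII].

THE POINT (LOCATED-UNRANGED-BUDGET, self-located).  FILE 5 (p633893) `datumGaugeSplitTopStepCoreG_of_prop6P_of_chart` and FILE 6 (p636413) quantify `HLETTERS` and `HBUDGET`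
over ALL letter sequences `ε δ : ℕ → ℝ` and levels `j`; but `HBUDGET` asks thresholds `t₂ > ¼M′·max{…} ≥ 0`, `t₃ > 0`, `t_∂ > 0` with `t₁ + (t₂ + t_∂) + t₃ ≤ Cδ_j + θε_j + Qε_j²`,
which at `δ_j = ε_j = 0` forces `t₁(ε, δ, j) < 0` — satisfiable only by letter functions doctored off the token's range.  Inside the token the letters are only ever read at
levels `j ≤ k` where `0 < δ_j ≤ a₁` and `B₃δ_j ≤ ε_j ≤ a₀` hold (the token's own range binders).  THIS FILE restates the knit and the stub-1 shape with the four range facts as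
antecedents of `HLETTERS` and `HBUDGET` (everything else byte-for-byte as in FILE 5∕6; proofs = FILE 5∕6's with the range facts read off the token's `hδ`∕`hε` at the datum's
level), so that the budget can be discharged by honest affine letters (`Cδ + θε + Qε²` shapes) — the editions consumers should key on.

WHAT IS PROVED (sorry-free; no definition; axioms standard).  ★★★ `datumGaugeSplitTopStepCoreG_of_prop6P_of_chartR F N` (FILE 5's knit, ranged `HLETTERS`∕`HBUDGET`); ★★★
`prop8StepCoPGShape_of_prop6P_of_chartR F N` (FILE 6's V20-G stub-1 shape, ranged; via k0-s1-w3 `prop8RegSepTopStepG_of_datumGaugeSplitCoreG`).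
HONEST SCOPE.  Count-neutral restatement-with-weaker-hypotheses of this seat's own FILE 5∕6 theorems (no other seat's declaration touched); [6] Prop. 6 (`hP6`), `HCHART`,
the ranged `HLETTERS`∕`HBUDGET`, `2L² ≤ B₃`, the smallness letters and `0 < a₀, a₁` are HYPOTHESES — displayed, NOT discharged, joint satisfiability at the record NOT claimed;
NO stub registered or closed; nothing of [15]∕[6]∕[4] ANALYSIS asserted; K0⁷ ∕ K1⁹ NOT closed; N07 ∕ N05 NOT discharged; counts unmoved (typed 28∕28 · discharged 5∕27); one finite
𝕋⁴ programme at fixed ε — the route closes the conditional finite-𝕋⁴ rung `BalabanLadder.UV` ONLY; the YM mass gap (Clay) is NOT proved by any of this; nothing continuum ∕ ℝ⁴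
∕ OS.  No `sorry`, no `def`, no `instance`, no `notation`.

RELATED IN THE TREE, NOT DUPLICATED: FILE 5 `N07SplitClauseHeadKnit` ∕ FILE 6 `N07SplitClauseHeadStub1G` (the unranged editions — superseded for consumers by this file, kept);
FILE 3, n07-w3 g7 `N07DatumGauge152Guarded`, k0-s1-w3 `K0HalvingStepOfCoreGuardedChain`, g3 `N07LocalLettersCoreGuarded` (CONSUMED BY NAME as in FILE 5∕6).

References: [15] (144) p. 300, (157)–(159) pp. 302–303, (162)–(166) pp. 303–304, (168) p. 304, Prop. 8 p. 304; [6] Prop. 6 p. 99, (1.3)–(1.9) p. 77, (1.54) p. 85;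
[4] (2.1)–(2.4) p. 224, Cor. 2.8 p. 249.
-/

set_option autoImplicit false

noncomputable section
open scoped BigOperators Matrix.Norms.L2Operator

namespace Summit.QuantumFields.YangMills.BalabanUVNodes.N07SplitClauseHeadKnitRanged

open Literature.MathematicalPhysics.QuantumFieldTheory.Balaban1983to89
open Literature.MathematicalPhysics.QuantumFieldTheory.Balaban1983to89.Node00
open Literature.MathematicalPhysics.QuantumFieldTheory.Balaban1983to89.B15DeterminingSets
open Literature.MathematicalPhysics.QuantumFieldTheory.Balaban1983to89.B12RegularSpaces111 (gaugeU expI grad)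
open B15Eq112TorusCover (cover)
open B14DomainGeom (Pt Within)
open B14.Eq213MaximalDomains (side cubeExt)
open B5Eq117TorusCarriers (Mk)
open B5Eq118OneStroke (iterBlockOf)
open B5Prop12FieldsLattice (distSite)
open B8Eq131Cubes (sqLo sqHi box cube)
open B8LeafModelZd (ZdIdx)
open B11Eq115Space (levOf)
open B6SectADomainsV1 (Domains)
open B6SectAOperatorsV1 (BondIdx RE dsE QpE)
open Literature.MathematicalPhysics.QuantumFieldTheory.BalabanImbrieJaffe1984to88.BIJ85AxialPropagator411 (BondSpace)
open T4Continuum (T4Family)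
open T4AxialGaugeSmallField (castSite)
open B16Sect1Backgrounds (toMS)
open GaugeField (gaugeAct)
open MatrixLog (mlog)
open Summit.QuantumFields.YangMills.Theorems.K0FlatCubeOpsTextP (flatH)
open Summit.QuantumFields.YangMills.BalabanUVNodes.N07HalvingStepTopOfLocalLetters (Letters10On)
open Summit.QuantumFields.YangMills.BalabanUVNodes.N07LocalLettersSplitCore (LocalGaugeSplitOn)
open Summit.QuantumFields.YangMills.BalabanUVNodes.N07LocalLettersCoreGuarded (DatumGaugeSplitTopStepCoreG)
open Summit.QuantumFields.YangMills.BalabanUVNodes.N07SplitClauseHeadAtCubeDomains (localGaugeSplitOn_head159_cubeDomains_box)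
open Summit.QuantumFields.YangMills.BalabanUVNodes.N07DatumGauge152Guarded (numerics_cornerP_of_levelGuard)
open Summit.QuantumFields.YangMills.BalabanUVNodes.N07DatumGauge152GuardedBox (datumGauge152_REfiner153_of_prop6P_guarded_box)
open Summit.QuantumFields.YangMills.BalabanUVNodes.N07SplitClauseLevelRaising (datumGaugeSplitTopStepCoreG_of_clean)
open Summit.QuantumFields.YangMills.Theorems.K0HalvingStepOfCoreGuardedChain (prop8RegSepTopStepG_of_datumGaugeSplitCoreG)

open scoped Classical in
/-- ★★★ **THE KNIT, RANGED LETTER HYPOTHESES** — FILE 5's `datumGaugeSplitTopStepCoreG_of_prop6P_of_chart` with `HLETTERS`∕`HBUDGET` asked only for `0 < δ_j ≤ a₁`,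
`B₃δ_j ≤ ε_j ≤ a₀` (the token's own range at the datum's level); everything else verbatim.
[cite: Balaban1985Variational, (144) p.300, (150)–(153) p.301, (157)–(159) pp.302–303, (162)–(166) pp.303–304, (168) p.304, Prop. 8 p.304; Balaban1985RegularSpaces, Prop. 6 (1.135)–(1.138) p.99, (1.131) p.99; Balaban1984PropagatorsII, (2.1)–(2.4) p.224, Cor. 2.8 (2.150)–(2.151) p.249] -/
theorem datumGaugeSplitTopStepCoreG_of_prop6P_of_chartR (F : T4Family) (N : ℕ) [NeZero N] :
    ∃ (Mh₀ R₀ : ℕ) (CS BS CH δH BH : ℝ), 0 ≤ CS ∧ 0 < BS ∧ 0 ≤ CH ∧ 0 < δH ∧ 0 < BH ∧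
    ∀ {B₁ c₁ : ℝ} (_ : 0 ≤ B₁) (_ : 0 < c₁) {ρ : ℕ}
      (_ : letI : CStarAlgebra (MatA N) := {}; B8.Prop6Printed 4 (F.L : ℝ) B₁ c₁ (fun i : ZdIdx 4 F.L => zdCubP (MatA N) F.L ρ i))
      -- structural letters: grid cube `Mc`, block height `a′` (`M_h = L^{a′} ≥ M_h⁰`), `R ≥ R₀`, the collar `ρ` with `L·M_h ∣ ρ`, `R·L·M_h ≤ ρ`, `L ≤ ρ`
      {Mc Mh R a' : ℕ} (_ : 1 ≤ Mc) (_ : Mc ≤ ρ) (_ : Mh = F.L ^ a') (_ : Mh₀ ≤ Mh) (_ : R₀ ≤ R) (_ : F.L * Mh ∣ ρ) (_ : R * (F.L * Mh) ≤ ρ) (hLρ : F.L ≤ ρ)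
      -- the two constants of the plan's V20-G guard `c ≤ ν.M₁ ∧ k + c₀ ≤ F.m + K` and their side conditions, stated once (n07-w3 g7's two + the head's two)
      {c c₀ : ℕ} (_ : (11 * 4 + 4 * ρ + Mc + 3) * F.L ≤ c) (_ : Mc + 11 * 4 + 6 * ρ ≤ 2 * F.L ^ c₀) (_ : F.m ≤ c₀) (_ : a' + 3 ≤ c₀)
      -- the token's letters, `0 < B₃`, `a₀ ≤ a0OfP`, the (163)-type letter `θ_H` of the `H` doors
      {B₃ C θ Q a₀ a₁ θH : ℝ} (_ : 0 < B₃) (_ : 0 ≤ C) (_ : 0 ≤ θ) (_ : 0 ≤ Q) (_ : a₀ ≤ a0OfP F N Mc ρ B₁ c₁) (_ : 8 * CH * BH * Real.exp (-(δH * (ρ : ℝ))) ≤ θH)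
      -- the chart side's PER-LEVEL SIZE LETTERS, functions of the letters `(ε, δ)` and the level only
      (β₁ β₂ s' σ t₁ : (ℕ → ℝ) → (ℕ → ℝ) → ℕ → ℝ) (v av : (ℕ → ℝ) → (ℕ → ℝ) → ℕ → ℕ → ℝ)
      -- ★ HLETTERS (RANGED): signs and the row budget, asked only IN THE TOKEN's RANGE `0 < δ_j ≤ a₁`, `B₃δ_j ≤ ε_j ≤ a₀`
      (_ : ∀ (K : ℕ) (ε δ : ℕ → ℝ) (j : ℕ), 0 < δ j → δ j ≤ a₁ → B₃ * δ j ≤ ε j → ε j ≤ a₀ →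
        0 ≤ β₁ ε δ j ∧ 0 ≤ β₂ ε δ j ∧ 0 ≤ s' ε δ j ∧ σ ε δ j ≤ 1 / 2 ∧ (∀ i, 0 ≤ v ε δ j i) ∧ (∀ i, 0 ≤ av ε δ j i) ∧
        (∀ i ≤ j, (((F.P K).d * ((sideP (F.P K) Mc ρ + 4 * ρ + 3) * (F.P K).L ^ (j - i)) : ℕ) : ℝ) * (v ε δ j i + av ε δ j i) ≤ σ ε δ j))
      -- ★ HBUDGET (RANGED): thresholds above the doors' floors summing below the token's threshold, IN THE TOKEN's RANGE
      (_ : ∀ (K : ℕ) (ε δ : ℕ → ℝ) (j : ℕ), 0 < δ j → δ j ≤ a₁ → B₃ * δ j ≤ ε j → ε j ≤ a₀ → ∃ t₂ t₃ tD : ℝ,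
        1 / 4 * ((sideP (F.P K) Mc ρ : ℕ) : ℝ) * max (4 * CH * BH * β₁ ε δ j) (θH * (β₂ ε δ j / ((sideP (F.P K) Mc ρ : ℕ) : ℝ))) < t₂ ∧
        1 / 4 * max (4 * CH * BH * s' ε δ j) (θH * s' ε δ j) < t₃ ∧ 2 * CS * BS * (4 * σ ε δ j) < tD ∧
        t₁ ε δ j + (t₂ + tD) + t₃ ≤ C * δ j + θ * ε j + Q * ε j ^ 2)
      -- ★ HCHART: the chart lane's per-datum deliverable (see FILE 4), at every datum of the token and every output of n07-w3's door
      (_ : ∀ (ν : Stage7Numerics) (M : ℕ) (g : ℕ → ℝ) (K k : ℕ) (s : SeqOfRecord F ν M g K k), Sect2.SeqSeparated ν.M₁ s → 0 < ν.M₁ →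
        c ≤ ν.M₁ ∧ k + c₀ ≤ F.m + K → 1 ≤ k →
        ∀ (ε δ : ℕ → ℝ),
        (∀ n, n ≤ k → 0 < δ n ∧ δ n ≤ a₁) → (∀ n, n < k → δ n ≤ 2 * δ (n + 1)) → (∀ n, n < k → δ (n + 1) ≤ 2 * δ n) →
        (∀ n, n ≤ k → B₃ * δ n ≤ ε n ∧ ε n ≤ a₀) → (∀ n, n < k → ε n ≤ 2 * ε (n + 1)) → (∀ n, n < k → ε (n + 1) ≤ 2 * ε n) →
        ∀ W : MSField (F.P K) (SU N), Sect2.DataSmall7PTop (avOfRecord F N K) s.Ω (suppDomOfRecord F ν K s.Ω) k δ W →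
        ∀ U : GaugeField (F.P K) 0 (SU N),
        (∀ n, n ≤ k → PlaqSmallOn (Sect2.omegaPlaqsTop s.Ω (suppDomOfRecord F ν K s.Ω) n) (ε n * (F.P K).eta n ^ 2) U) →
        (∀ n, n ≤ k → Sect2.CoDivSmallOn (Sect2.omegaBondsTop s.Ω (suppDomOfRecord F ν K s.Ω) n) (ε n * (F.P K).eta n ^ 3) U) →
        AgreeOn (genSet s.Ω k) (avgFamily (avOfRecord F N K) U) W → IsCritOnFibre F N K (genSet s.Ω k) W U →
        ∀ (n : ℕ) (hk : K - n ≤ (F.P K).m + (F.P K).K), 1 ≤ K - n → K - n ≤ k → ∀ (idx : Pt (F.P K).d),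
        -- CLEAN DATUMS ONLY (print p. 300 «□ intersecting Ω_j but not Ω_{j+1}»; n07-e LOCATED-INWARD-DATUM): top level, or the print box misses `Ω_{j+1}`
        (K - n = k ∨ ∀ z ∈ box (F.P K).L (cornerP (F.P K) Mc ρ idx) (sideP (F.P K) Mc ρ) (K - n), cover (F.P K) z ∉ s.Ω (K - n + 1)) →
        ∀ {HVd : Domains (F.P K)} (_ : HVd = cubeDomains (F.P K) (cornerP (F.P K) Mc ρ idx) (sideP (F.P K) Mc ρ) ρ (K - n) hk)
          (lo hi : ℕ → Pt (F.P K).d),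
        lo 0 = (fun i => ((F.P K).L : ℤ) * (sqLo (F.P K).L (cornerP (F.P K) Mc ρ idx) ρ (K - n) 1 i - 1)) →
        hi 0 = (fun i => ((F.P K).L : ℤ) * (sqHi (F.P K).L (cornerP (F.P K) Mc ρ idx) (sideP (F.P K) Mc ρ) ρ (K - n) 1 i + 1) + (((F.P K).L : ℤ) - 1)) →
        (∀ j', 1 ≤ j' → lo j' = sqLo (F.P K).L (cornerP (F.P K) Mc ρ idx) ρ (K - n) j' - 1) →
        (∀ j', 1 ≤ j' → hi j' = sqHi (F.P K).L (cornerP (F.P K) Mc ρ idx) (sideP (F.P K) Mc ρ) ρ (K - n) j' + 1) →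
        ∃ HV : (BondIdx HVd → MatA N) →ₗ[ℂ] (PBond (F.P K) 0 → MatA N),
          (∀ (Bf : BondIdx HVd → MatA N) (b : PBond (F.P K) 0), HV Bf b = ∑ c, ((flatH (F.P K) (K - n) HVd (Pi.single c 1) b : ℝ) : ℂ) • Bf c) ∧
        ∀ (u : GaugeTransf (F.P K) 0 (SU N)) (A : PBond (F.P K) 0 → MatA N),
        (∀ b ∈ (Sect2.regionOfSet (F.P K) (cover (F.P K) '' box (F.P K).L (cornerP (F.P K) Mc ρ idx) (sideP (F.P K) Mc ρ) (K - n))).bonds,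
          gaugeU (fun x => ιSU N (u x)) (fun b' => ιSU N (U b')) b = expI ((F.P K).eta (K - n)) (A b)) →
        (∀ b ∈ (Sect2.regionOfSet (F.P K) (cover (F.P K) '' box (F.P K).L (cornerP (F.P K) Mc ρ idx) (sideP (F.P K) Mc ρ) (K - n))).bonds,
          ‖A b‖ < b9OfP F Mc ρ B₁ * ε (K - n)) →
        (∀ q ∈ (Sect2.regionOfSet (F.P K) (cover (F.P K) '' box (F.P K).L (cornerP (F.P K) Mc ρ idx) (sideP (F.P K) Mc ρ) (K - n))).dpairs,
          ‖grad ((F.P K).eta (K - n)) q.2.1 (fun y => A ⟨y, q.2.2⟩) q.1‖ < b9OfP F Mc ρ B₁ * ε (K - n)) →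
        (∀ b ∈ Sect2.bondsDeep (cover (F.P K) '' box (F.P K).L (cornerP (F.P K) Mc ρ idx) (sideP (F.P K) Mc ρ) (K - n)),
          ‖Sect2.codiffCurlA ((F.P K).eta (K - n)) A b.src b.dir‖ < b9OfP F Mc ρ B₁ * ε (K - n)) →
        (∀ b ∈ Sect2.bondsDeep (cover (F.P K) '' box (F.P K).L (cornerP (F.P K) Mc ρ idx) (sideP (F.P K) Mc ρ) (K - n)),
          ‖∑ ν' : Fin (F.P K).d, (((F.P K).eta (K - n) : ℝ) : ℂ)⁻¹ •
              (grad ((F.P K).eta (K - n)) ν' (fun y => A ⟨y, b.dir⟩) (b.src.unshift ν') - grad ((F.P K).eta (K - n)) ν' (fun y => A ⟨y, b.dir⟩) b.src)‖ <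
            b9OfP F Mc ρ B₁ * ε (K - n)) →
        (∀ D' : Domains (F.P K), LinearMap.ker (QpE D') ≤ LinearMap.ker (QpE HVd) → ∀ φ : MatA N →L[ℂ] ℂ,
          RE D' ((F.P K).eta (K - n))⁻¹ (dsE ((F.P K).eta (K - n))⁻¹ (WithLp.toLp 2 fun b => (φ (A b)).re : BondSpace (F.P K))) = 0 ∧
          RE D' ((F.P K).eta (K - n))⁻¹ (dsE ((F.P K).eta (K - n))⁻¹ (WithLp.toLp 2 fun b => (φ (A b)).im : BondSpace (F.P K))) = 0) →
        ∃ (xc : Pt (F.P K).d) (B B' : BondIdx HVd → MatA N) (A₁ : PBond (F.P K) 0 → MatA N)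
          (uL : GaugeTransf (F.P K) 0 (SU N)) (U₁ : GaugeField (F.P K) 0 (SU N)) (lam : (j : ℕ) → Site (F.P K) j → MatA N) (X : BondIdx HVd → MatA N),
          xc ∈ box (F.P K).L (cornerP (F.P K) Mc ρ idx) (sideP (F.P K) Mc ρ) (K - n) ∧
          (∀ c : BondIdx HVd, (c.1.1 : ℕ) = K - n →
            ‖B c‖ ≤ β₁ ε δ (K - n) * (distSite (Mk (F.P K) (c.1.1 : ℕ)) c.1.2.src (iterBlockOf (c.1.1 : ℕ) (cover (F.P K) xc)) + 1)) ∧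
          (∀ c : BondIdx HVd, (c.1.1 : ℕ) < K - n → ‖B c‖ ≤ β₂ ε δ (K - n)) ∧
          (∀ c, ‖B' c‖ ≤ s' ε δ (K - n)) ∧
          (∀ j' ≤ K - n, ∀ c : PBond (F.P K) j', c.src ∈ (castSite '' Set.Icc (lo j') (hi j') : Set (Site (F.P K) j')) →
            c.tgt ∈ (castSite '' Set.Icc (lo j') (hi j') : Set (Site (F.P K) j')) →
              dist1 (Averaging.iter (avOfRecord F N K) j' (gaugeAct uL U₁) c) ≤ v ε δ (K - n) j') ∧
          (∀ j' ≤ K - n, ∀ c : PBond (F.P K) j', c.src ∈ (castSite '' Set.Icc (lo j') (hi j') : Set (Site (F.P K) j')) →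
            c.tgt ∈ (castSite '' Set.Icc (lo j') (hi j') : Set (Site (F.P K) j')) → dist1 (Averaging.iter (avOfRecord F N K) j' U₁ c) ≤ av ε δ (K - n) j') ∧
          (∀ (j' : ℕ) (y : Site (F.P K) j'), ‖lam j' y‖ ≤ ‖mlog (((((toMS uL j' (castSite (lo j')))⁻¹ * toMS uL j' y)⁻¹ : SU N)) : MatA N)‖) ∧
          (∀ c : BondIdx HVd, X c = LatticeFieldCalculus.grad (((F.P K).L : ℝ) ^ (K - n) / ((F.P K).L : ℝ) ^ (c.1.1 : ℕ)) (lam c.1.1) c.1.2) ∧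
          Letters10On (cover (F.P K) '' box (F.P K).L (cornerP (F.P K) Mc ρ idx) (sideP (F.P K) Mc ρ) (K - n)) ((F.P K).eta (K - n)) (t₁ ε δ (K - n)) A₁ ∧
          (∀ b, A b - HV X b = A₁ b + HV B b - HV B' b)),
      DatumGaugeSplitTopStepCoreG F N (fun ν K Ω => suppDomOfRecord F ν K Ω) Mc ρ (fun ν _ _ K k _ => c ≤ ν.M₁ ∧ k + c₀ ≤ F.m + K)
        B₃ C θ Q (b9OfP F Mc ρ B₁) a₀ a₁ := by
  obtain ⟨Mh₀, R₀, CS, BS, CH, δH, BH, hCS, hBS, hCH, hδH, hBH, hmain⟩ := localGaugeSplitOn_head159_cubeDomains_box F N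
  refine ⟨Mh₀, R₀, CS, BS, CH, δH, BH, hCS, hBS, hCH, hδH, hBH, ?_⟩
  intro B₁ c₁ hB₁ hc₁ ρ hP6 Mc Mh R a' hMc hMcρ hMha hMh hR hdvd hRρ hLρ c c₀ hc hc₀ hmc₀ hac₀ B₃ C θ Q a₀ a₁ θH hB₃ hC0 hθ0 hQ0 ha₀ h163 β₁ β₂ s' σ t₁ v av
    hletters hbudget hchart
  -- the level-raising reduction (n07-e): the clause is owed at CLEAN datums whose print box meets `Ω_j`
  refine datumGaugeSplitTopStepCoreG_of_clean F N hMc hMcρ hB₃.le (b9OfP_pos (F := F) Mc ρ hB₁).le hC0 hθ0 hQ0 ?_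
  intro ν M g K k s hsep hM₁ hadm hk ε δ hδ hcompδ hcompδ' hε hεcomp hεcomp' W h7 U h17 h19 hfib hcrit j hj hjk a hmeet hclean
  -- the level guard with `F.m ≤ c₀` puts every datum level below `K`: write it as `K − n`
  have hkK : k ≤ K := by have := hadm.2; omega
  obtain ⟨n, rfl⟩ : ∃ n, j = K - n := ⟨K - j, by omega⟩
  have hk1 : 1 ≤ K - n := hj
  have hkP : K - n ≤ (F.P K).m + (F.P K).K := by
    have : (F.P K).m + (F.P K).K = F.m + K := rfl
    omega
  have hLρ' : (F.P K).L ≤ ρ := hLρ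
  -- the letters' ranges at the datum's level
  have hr1 : 0 < δ (K - n) := (hδ _ hjk).1
  have hr2 : δ (K - n) ≤ a₁ := (hδ _ hjk).2
  have hr3 : B₃ * δ (K - n) ≤ ε (K - n) := (hε _ hjk).1
  have hr4 : ε (K - n) ≤ a₀ := (hε _ hjk).2
  have hε' : ∀ m, m ≤ k → 0 < ε m ∧ ε m ≤ a₀ := fun m hm => ⟨lt_of_lt_of_le (mul_pos hB₃ (hδ m hm).1) (hε m hm).1, (hε m hm).2⟩
  obtain ⟨hβ₁, hβ₂, hs', hσ, hv0, ha0, hDσ⟩ := hletters K ε δ (K - n) hr1 hr2 hr3 hr4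
  obtain ⟨t₂, t₃, tD, ht₂, ht₃, htD, hsum⟩ := hbudget K ε δ (K - n) hr1 hr2 hr3 hr4
  -- S3's gauge at this datum under the V20-G guard, BOX-keyed meeting (n07-w3 g7, by name), and the datum's numerics from the level guard
  obtain ⟨u, A, he, hA, hdA, hcd, hlap, h6⟩ := datumGauge152_REfiner153_of_prop6P_guarded_box (F := F) (N := N) hB₁ hc₁ hP6 hMc hc hc₀ ν g K k hLρ' s hsep hadm ε
    ha₀ hε' hεcomp U h17 h19 hk1 hjk a hmeet
  obtain ⟨ha, hM, hper, hinj⟩ := numerics_cornerP_of_levelGuard F hk1 hjk hadm.2 hMha (by omega) hLρ' hdvd hc₀ a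
  have hρpos : 0 < ρ := lt_of_lt_of_le (F.P K).L_pos hLρ'
  have hM1 : 1 ≤ sideP (F.P K) Mc ρ := by have := le_sideP (P := F.P K) Mc hρpos; omega
  -- the canonical boxes of the datum's tower
  set lo : ℕ → Pt (F.P K).d := fun j' => if j' = 0 then (fun i => ((F.P K).L : ℤ) * (sqLo (F.P K).L (cornerP (F.P K) Mc ρ a) ρ (K - n) 1 i - 1))
    else sqLo (F.P K).L (cornerP (F.P K) Mc ρ a) ρ (K - n) j' - 1 with hlo
  set hi : ℕ → Pt (F.P K).d := fun j' => if j' = 0 then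
      (fun i => ((F.P K).L : ℤ) * (sqHi (F.P K).L (cornerP (F.P K) Mc ρ a) (sideP (F.P K) Mc ρ) ρ (K - n) 1 i + 1) + (((F.P K).L : ℤ) - 1))
    else sqHi (F.P K).L (cornerP (F.P K) Mc ρ a) (sideP (F.P K) Mc ρ) ρ (K - n) j' + 1 with hhi
  have hlo0 : lo 0 = fun i => ((F.P K).L : ℤ) * (sqLo (F.P K).L (cornerP (F.P K) Mc ρ a) ρ (K - n) 1 i - 1) := by simp [hlo]
  have hhi0 : hi 0 = fun i => ((F.P K).L : ℤ) * (sqHi (F.P K).L (cornerP (F.P K) Mc ρ a) (sideP (F.P K) Mc ρ) ρ (K - n) 1 i + 1) + (((F.P K).L : ℤ) - 1) := by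
    simp [hhi]
  have hloj : ∀ j', 1 ≤ j' → lo j' = sqLo (F.P K).L (cornerP (F.P K) Mc ρ a) ρ (K - n) j' - 1 := fun j' hj' => by
    simp [hlo, Nat.one_le_iff_ne_zero.mp hj']
  have hhij : ∀ j', 1 ≤ j' → hi j' = sqHi (F.P K).L (cornerP (F.P K) Mc ρ a) (sideP (F.P K) Mc ρ) ρ (K - n) j' + 1 := fun j' hj' => by
    simp [hhi, Nat.one_le_iff_ne_zero.mp hj']
  -- the chart side at this CLEAN datum and gauge
  obtain ⟨HV, hHV, hch⟩ := hchart ν M g K k s hsep hM₁ hadm hk ε δ hδ hcompδ hcompδ' hε hεcomp hεcomp' W h7 U h17 h19 hfib hcrit n hkP hk1 hjk a hclean rfl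
    lo hi hlo0 hhi0 hloj hhij
  obtain ⟨xc, B, B', A₁, uL, U₁, lam, X, hxc, hX₁, hX₂, hB', hv, hav, hlam, hX, h₁, h159⟩ := hch u A he hA hdA hcd hlap (fun D' hD' φ => h6 hkP D' hD' φ)
  -- FILE 3 at this datum, then down to the token's threshold
  have hclause := hmain n K hk1 (by omega) hkP hMha hMh hR (by omega) hM1 hdvd ha hM hper hRρ hLρ hinj hHV hxc hβ₁ hβ₂ h163 hX₁ hX₂ hs' hB'
    hlo0 hhi0 hloj hhij uL U₁ (v ε δ (K - n)) (av ε δ (K - n)) hv0 ha0 hσ hDσ hv hav lam hlam hX u he hA hdA h₁ h159 ht₂ ht₃ htD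
  exact hclause.of_le le_rfl hsum

open scoped Classical in
/-- ★★★ **THE V20-G STUB-1 SHAPE, RANGED LETTER HYPOTHESES** — FILE 6's `prop8StepCoPGShape_of_prop6P_of_chart` with the ranged `HLETTERS`∕`HBUDGET`; via k0-s1-w3's
`prop8RegSepTopStepG_of_datumGaugeSplitCoreG` (`2L² ≤ B₃`, smallness, `κ := b9OfP F Mc ρ B₁ > 0`).  No stub registered or closed.
[cite: Balaban1985Variational, Prop. 8 p.304, (162)–(168) pp.303–304; Balaban1985RegularSpaces, Prop. 6 p.99, (1.3)–(1.9) p.77; Balaban1987RG1, (0.1) p.251] -/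
theorem prop8StepCoPGShape_of_prop6P_of_chartR (F : T4Family) (N : ℕ) [NeZero N] :
    ∃ (Mh₀ R₀ : ℕ) (CS BS CH δH BH : ℝ), 0 ≤ CS ∧ 0 < BS ∧ 0 ≤ CH ∧ 0 < δH ∧ 0 < BH ∧
    ∀ {B₁ c₁ : ℝ} (_ : 0 ≤ B₁) (_ : 0 < c₁) {ρ : ℕ}
      (_ : letI : CStarAlgebra (MatA N) := {}; B8.Prop6Printed 4 (F.L : ℝ) B₁ c₁ (fun i : ZdIdx 4 F.L => zdCubP (MatA N) F.L ρ i))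
      -- structural letters: grid cube `Mc`, block height `a′` (`M_h = L^{a′} ≥ M_h⁰`), `R ≥ R₀`, the collar `ρ` with `L·M_h ∣ ρ`, `R·L·M_h ≤ ρ`, `L ≤ ρ`
      {Mc Mh R a' : ℕ} (_ : 1 ≤ Mc) (_ : Mc ≤ ρ) (_ : Mh = F.L ^ a') (_ : Mh₀ ≤ Mh) (_ : R₀ ≤ R) (_ : F.L * Mh ∣ ρ) (_ : R * (F.L * Mh) ≤ ρ) (hLρ : F.L ≤ ρ)
      -- the two constants of the plan's V20-G guard `c ≤ ν.M₁ ∧ k + c₀ ≤ F.m + K` and their side conditions, stated once (n07-w3 g7's two + the head's two)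
      {c c₀ : ℕ} (_ : (11 * 4 + 4 * ρ + Mc + 3) * F.L ≤ c) (_ : Mc + 11 * 4 + 6 * ρ ≤ 2 * F.L ^ c₀) (_ : F.m ≤ c₀) (_ : a' + 3 ≤ c₀)
      -- the token's letters, `0 < B₃`, `a₀ ≤ a0OfP`, the (163)-type letter `θ_H` of the `H` doors
      {B₃ C θ Q a₀ a₁ θH : ℝ} (_ : 0 < B₃) (_ : 0 ≤ C) (_ : 0 ≤ θ) (_ : 0 ≤ Q) (_ : a₀ ≤ a0OfP F N Mc ρ B₁ c₁) (_ : 8 * CH * BH * Real.exp (-(δH * (ρ : ℝ))) ≤ θH)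
      -- V19's floor `2L² ≤ B₃` and the (162)–(166♭) smallness letters of the R0′ closers, `κ := b9OfP F Mc ρ B₁`
      (_ : 2 * (F.L : ℝ) ^ 2 ≤ B₃) (_ : 4 * C ≤ B₃) (_ : 16 * θ ≤ 1) (_ : 0 ≤ Q) (_ : (16 * Q + 1024 * b9OfP F Mc ρ B₁ ^ 2) * a₀ ≤ 1)
      (_ : 32 * b9OfP F Mc ρ B₁ * a₀ ≤ 1) (_ : 0 < a₀) (_ : 0 < a₁)
      -- the chart side's PER-LEVEL SIZE LETTERS, functions of the letters `(ε, δ)` and the level only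
      (β₁ β₂ s' σ t₁ : (ℕ → ℝ) → (ℕ → ℝ) → ℕ → ℝ) (v av : (ℕ → ℝ) → (ℕ → ℝ) → ℕ → ℕ → ℝ)
      -- ★ HLETTERS (RANGED): signs and the row budget, asked only IN THE TOKEN's RANGE `0 < δ_j ≤ a₁`, `B₃δ_j ≤ ε_j ≤ a₀`
      (_ : ∀ (K : ℕ) (ε δ : ℕ → ℝ) (j : ℕ), 0 < δ j → δ j ≤ a₁ → B₃ * δ j ≤ ε j → ε j ≤ a₀ →
        0 ≤ β₁ ε δ j ∧ 0 ≤ β₂ ε δ j ∧ 0 ≤ s' ε δ j ∧ σ ε δ j ≤ 1 / 2 ∧ (∀ i, 0 ≤ v ε δ j i) ∧ (∀ i, 0 ≤ av ε δ j i) ∧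
        (∀ i ≤ j, (((F.P K).d * ((sideP (F.P K) Mc ρ + 4 * ρ + 3) * (F.P K).L ^ (j - i)) : ℕ) : ℝ) * (v ε δ j i + av ε δ j i) ≤ σ ε δ j))
      -- ★ HBUDGET (RANGED): thresholds above the doors' floors summing below the token's threshold, IN THE TOKEN's RANGE
      (_ : ∀ (K : ℕ) (ε δ : ℕ → ℝ) (j : ℕ), 0 < δ j → δ j ≤ a₁ → B₃ * δ j ≤ ε j → ε j ≤ a₀ → ∃ t₂ t₃ tD : ℝ,
        1 / 4 * ((sideP (F.P K) Mc ρ : ℕ) : ℝ) * max (4 * CH * BH * β₁ ε δ j) (θH * (β₂ ε δ j / ((sideP (F.P K) Mc ρ : ℕ) : ℝ))) < t₂ ∧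
        1 / 4 * max (4 * CH * BH * s' ε δ j) (θH * s' ε δ j) < t₃ ∧ 2 * CS * BS * (4 * σ ε δ j) < tD ∧
        t₁ ε δ j + (t₂ + tD) + t₃ ≤ C * δ j + θ * ε j + Q * ε j ^ 2)
      -- ★ HCHART: the chart lane's per-datum deliverable (see FILE 4), at every datum of the token and every output of n07-w3's door
      (_ : ∀ (ν : Stage7Numerics) (M : ℕ) (g : ℕ → ℝ) (K k : ℕ) (s : SeqOfRecord F ν M g K k), Sect2.SeqSeparated ν.M₁ s → 0 < ν.M₁ →
        c ≤ ν.M₁ ∧ k + c₀ ≤ F.m + K → 1 ≤ k →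
        ∀ (ε δ : ℕ → ℝ),
        (∀ n, n ≤ k → 0 < δ n ∧ δ n ≤ a₁) → (∀ n, n < k → δ n ≤ 2 * δ (n + 1)) → (∀ n, n < k → δ (n + 1) ≤ 2 * δ n) →
        (∀ n, n ≤ k → B₃ * δ n ≤ ε n ∧ ε n ≤ a₀) → (∀ n, n < k → ε n ≤ 2 * ε (n + 1)) → (∀ n, n < k → ε (n + 1) ≤ 2 * ε n) →
        ∀ W : MSField (F.P K) (SU N), Sect2.DataSmall7PTop (avOfRecord F N K) s.Ω (suppDomOfRecord F ν K s.Ω) k δ W →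
        ∀ U : GaugeField (F.P K) 0 (SU N),
        (∀ n, n ≤ k → PlaqSmallOn (Sect2.omegaPlaqsTop s.Ω (suppDomOfRecord F ν K s.Ω) n) (ε n * (F.P K).eta n ^ 2) U) →
        (∀ n, n ≤ k → Sect2.CoDivSmallOn (Sect2.omegaBondsTop s.Ω (suppDomOfRecord F ν K s.Ω) n) (ε n * (F.P K).eta n ^ 3) U) →
        AgreeOn (genSet s.Ω k) (avgFamily (avOfRecord F N K) U) W → IsCritOnFibre F N K (genSet s.Ω k) W U →
        ∀ (n : ℕ) (hk : K - n ≤ (F.P K).m + (F.P K).K), 1 ≤ K - n → K - n ≤ k → ∀ (idx : Pt (F.P K).d),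
        -- CLEAN DATUMS ONLY (print p. 300 «□ intersecting Ω_j but not Ω_{j+1}»; n07-e LOCATED-INWARD-DATUM): top level, or the print box misses `Ω_{j+1}`
        (K - n = k ∨ ∀ z ∈ box (F.P K).L (cornerP (F.P K) Mc ρ idx) (sideP (F.P K) Mc ρ) (K - n), cover (F.P K) z ∉ s.Ω (K - n + 1)) →
        ∀ {HVd : Domains (F.P K)} (_ : HVd = cubeDomains (F.P K) (cornerP (F.P K) Mc ρ idx) (sideP (F.P K) Mc ρ) ρ (K - n) hk)
          (lo hi : ℕ → Pt (F.P K).d),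
        lo 0 = (fun i => ((F.P K).L : ℤ) * (sqLo (F.P K).L (cornerP (F.P K) Mc ρ idx) ρ (K - n) 1 i - 1)) →
        hi 0 = (fun i => ((F.P K).L : ℤ) * (sqHi (F.P K).L (cornerP (F.P K) Mc ρ idx) (sideP (F.P K) Mc ρ) ρ (K - n) 1 i + 1) + (((F.P K).L : ℤ) - 1)) →
        (∀ j', 1 ≤ j' → lo j' = sqLo (F.P K).L (cornerP (F.P K) Mc ρ idx) ρ (K - n) j' - 1) →
        (∀ j', 1 ≤ j' → hi j' = sqHi (F.P K).L (cornerP (F.P K) Mc ρ idx) (sideP (F.P K) Mc ρ) ρ (K - n) j' + 1) →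
        ∃ HV : (BondIdx HVd → MatA N) →ₗ[ℂ] (PBond (F.P K) 0 → MatA N),
          (∀ (Bf : BondIdx HVd → MatA N) (b : PBond (F.P K) 0), HV Bf b = ∑ c, ((flatH (F.P K) (K - n) HVd (Pi.single c 1) b : ℝ) : ℂ) • Bf c) ∧
        ∀ (u : GaugeTransf (F.P K) 0 (SU N)) (A : PBond (F.P K) 0 → MatA N),
        (∀ b ∈ (Sect2.regionOfSet (F.P K) (cover (F.P K) '' box (F.P K).L (cornerP (F.P K) Mc ρ idx) (sideP (F.P K) Mc ρ) (K - n))).bonds,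
          gaugeU (fun x => ιSU N (u x)) (fun b' => ιSU N (U b')) b = expI ((F.P K).eta (K - n)) (A b)) →
        (∀ b ∈ (Sect2.regionOfSet (F.P K) (cover (F.P K) '' box (F.P K).L (cornerP (F.P K) Mc ρ idx) (sideP (F.P K) Mc ρ) (K - n))).bonds,
          ‖A b‖ < b9OfP F Mc ρ B₁ * ε (K - n)) →
        (∀ q ∈ (Sect2.regionOfSet (F.P K) (cover (F.P K) '' box (F.P K).L (cornerP (F.P K) Mc ρ idx) (sideP (F.P K) Mc ρ) (K - n))).dpairs,
          ‖grad ((F.P K).eta (K - n)) q.2.1 (fun y => A ⟨y, q.2.2⟩) q.1‖ < b9OfP F Mc ρ B₁ * ε (K - n)) →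
        (∀ b ∈ Sect2.bondsDeep (cover (F.P K) '' box (F.P K).L (cornerP (F.P K) Mc ρ idx) (sideP (F.P K) Mc ρ) (K - n)),
          ‖Sect2.codiffCurlA ((F.P K).eta (K - n)) A b.src b.dir‖ < b9OfP F Mc ρ B₁ * ε (K - n)) →
        (∀ b ∈ Sect2.bondsDeep (cover (F.P K) '' box (F.P K).L (cornerP (F.P K) Mc ρ idx) (sideP (F.P K) Mc ρ) (K - n)),
          ‖∑ ν' : Fin (F.P K).d, (((F.P K).eta (K - n) : ℝ) : ℂ)⁻¹ •
              (grad ((F.P K).eta (K - n)) ν' (fun y => A ⟨y, b.dir⟩) (b.src.unshift ν') - grad ((F.P K).eta (K - n)) ν' (fun y => A ⟨y, b.dir⟩) b.src)‖ <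
            b9OfP F Mc ρ B₁ * ε (K - n)) →
        (∀ D' : Domains (F.P K), LinearMap.ker (QpE D') ≤ LinearMap.ker (QpE HVd) → ∀ φ : MatA N →L[ℂ] ℂ,
          RE D' ((F.P K).eta (K - n))⁻¹ (dsE ((F.P K).eta (K - n))⁻¹ (WithLp.toLp 2 fun b => (φ (A b)).re : BondSpace (F.P K))) = 0 ∧
          RE D' ((F.P K).eta (K - n))⁻¹ (dsE ((F.P K).eta (K - n))⁻¹ (WithLp.toLp 2 fun b => (φ (A b)).im : BondSpace (F.P K))) = 0) →
        ∃ (xc : Pt (F.P K).d) (B B' : BondIdx HVd → MatA N) (A₁ : PBond (F.P K) 0 → MatA N)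
          (uL : GaugeTransf (F.P K) 0 (SU N)) (U₁ : GaugeField (F.P K) 0 (SU N)) (lam : (j : ℕ) → Site (F.P K) j → MatA N) (X : BondIdx HVd → MatA N),
          xc ∈ box (F.P K).L (cornerP (F.P K) Mc ρ idx) (sideP (F.P K) Mc ρ) (K - n) ∧
          (∀ c : BondIdx HVd, (c.1.1 : ℕ) = K - n →
            ‖B c‖ ≤ β₁ ε δ (K - n) * (distSite (Mk (F.P K) (c.1.1 : ℕ)) c.1.2.src (iterBlockOf (c.1.1 : ℕ) (cover (F.P K) xc)) + 1)) ∧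
          (∀ c : BondIdx HVd, (c.1.1 : ℕ) < K - n → ‖B c‖ ≤ β₂ ε δ (K - n)) ∧
          (∀ c, ‖B' c‖ ≤ s' ε δ (K - n)) ∧
          (∀ j' ≤ K - n, ∀ c : PBond (F.P K) j', c.src ∈ (castSite '' Set.Icc (lo j') (hi j') : Set (Site (F.P K) j')) →
            c.tgt ∈ (castSite '' Set.Icc (lo j') (hi j') : Set (Site (F.P K) j')) →
              dist1 (Averaging.iter (avOfRecord F N K) j' (gaugeAct uL U₁) c) ≤ v ε δ (K - n) j') ∧
          (∀ j' ≤ K - n, ∀ c : PBond (F.P K) j', c.src ∈ (castSite '' Set.Icc (lo j') (hi j') : Set (Site (F.P K) j')) →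
            c.tgt ∈ (castSite '' Set.Icc (lo j') (hi j') : Set (Site (F.P K) j')) → dist1 (Averaging.iter (avOfRecord F N K) j' U₁ c) ≤ av ε δ (K - n) j') ∧
          (∀ (j' : ℕ) (y : Site (F.P K) j'), ‖lam j' y‖ ≤ ‖mlog (((((toMS uL j' (castSite (lo j')))⁻¹ * toMS uL j' y)⁻¹ : SU N)) : MatA N)‖) ∧
          (∀ c : BondIdx HVd, X c = LatticeFieldCalculus.grad (((F.P K).L : ℝ) ^ (K - n) / ((F.P K).L : ℝ) ^ (c.1.1 : ℕ)) (lam c.1.1) c.1.2) ∧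
          Letters10On (cover (F.P K) '' box (F.P K).L (cornerP (F.P K) Mc ρ idx) (sideP (F.P K) Mc ρ) (K - n)) ((F.P K).eta (K - n)) (t₁ ε δ (K - n)) A₁ ∧
          (∀ b, A b - HV X b = A₁ b + HV B b - HV B' b)),
      ∃ (c' c₀' : ℕ) (B₃' a₀' a₁' : ℝ), 2 * (F.L : ℝ) ^ 2 ≤ B₃' ∧ 0 < a₀' ∧ 0 < a₁' ∧
        Prop8RegSepTopStepG F N (fun ν K Ω => suppDomOfRecord F ν K Ω) (fun ν _ _ K k _ => c' ≤ ν.M₁ ∧ k + c₀' ≤ F.m + K) B₃' a₀' a₁' := by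
  obtain ⟨Mh₀, R₀, CS, BS, CH, δH, BH, hCS, hBS, hCH, hδH, hBH, hmain⟩ := datumGaugeSplitTopStepCoreG_of_prop6P_of_chartR F N
  refine ⟨Mh₀, R₀, CS, BS, CH, δH, BH, hCS, hBS, hCH, hδH, hBH, ?_⟩
  intro B₁ c₁ hB₁ hc₁ ρ hP6 Mc Mh R a' hMc hMcρ hMha hMh hR hdvd hRρ hLρ c c₀ hc hc₀ hmc₀ hac₀ B₃ C θ Q a₀ a₁ θH hB₃ hC0 hθ0 hQ0 ha₀ h163 hB₃L hC hθ hQ ha hκa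
    ha₀' ha₁ β₁ β₂ s' σ t₁ v av hletters hbudget hchart
  exact ⟨c, c₀, B₃, a₀, a₁, hB₃L, ha₀', ha₁,
    prop8RegSepTopStepG_of_datumGaugeSplitCoreG hMc hLρ
      (hmain hB₁ hc₁ hP6 hMc hMcρ hMha hMh hR hdvd hRρ hLρ hc hc₀ hmc₀ hac₀ hB₃ hC0 hθ0 hQ0 ha₀ h163 β₁ β₂ s' σ t₁ v av hletters hbudget hchart)
      hB₃L hC hθ hQ (b9OfP_pos (F := F) Mc ρ hB₁).le ha hκa⟩

end Summit.QuantumFields.YangMills.BalabanUVNodes.N07SplitClauseHeadKnitRanged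

end
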